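import Literature.MathematicalPhysics.QuantumFieldTheory.Balaban1983to89.B9Eq3152GtildeThirdWordTwoSided
import Literature.MathematicalPhysics.QuantumFieldTheory.Balaban1983to89.B9Eq343BlockLocalisedHolderPieces
import Literature.MathematicalPhysics.QuantumFieldTheory.Balaban1983to89.B11Eq117FrakGkPiTransformationNorm

/-!
# `Balaban1983to89.B9Eq3152ThirdWordPiGradRowOfHolderLetters` — T. Bałaban, *Propagators for lattice gauge theories in a background field*, Commun. Math. Phys. **99**
# (1985) 389–434 [Balaban1985BackgroundPropagators] Thm 3.13 p. 426 (*«Theorems 3.3, 3.10, 3.11 hold for the propagator 𝔊, with the exception of the inequality in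
# (3.42) involving the covariant Laplace operator»*), p. 426 (*«The formulas (3.147), (3.153) permit us to reduce properties of the operators 𝔓, 𝔊 to the
# corresponding properties of the operators G′, (Q′G′²Q′\*)⁻¹, G₁, (QG₁Q\*)⁻¹»*), Thm 3.1 (3.42)–(3.44) pp. 397–398 (the sup rows, the Hölder members
# *«‖ζ∇_UG′(U)λ‖_β, ‖ζG′(U)∇\*_Uλ‖_β ≤ B₀(β)…»* and the second-order member *«|(∇_UG′(U)∇\*_Uλ)(x)| ≤ B′₀(ε)(…‖λ‖_ε… + |λ|)… supp λ ⊂ Δ̃(y′)»*), p. 398 (*«the choice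
# of derivatives ∇_U, ∇\*_U is conventional»*), (3.40) p. 397, (3.152)–(3.153) p. 426, with [Balaban1985Variational] (117) p. 295: **STOREY H REDUCED TO PRINT — THE LOCAL
# SLICE-GRADIENT ROW OF THE THIRD WORD `G̃_kD_UR_kD*_UG̃_k = D_UG′_kR_kG′_kD*_U` OF `𝔊̃_k` (the one displayed letter `H3` of this lineage's G-3
# `B11Eq117FrakGkPiTransformationNorm`) FOLLOWS FROM TWO DISPLAYED LETTERS ON THE SITE PROPAGATOR `G′_k(U)` OF Thm 3.1 — (HLa) the weighted value ∕ η-scale Hölder rows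
# of `R_kG′_kD*_U` on block-supported sup data ((3.43)₂ and the sup ∕ gradient rows of `R_k = I − G′_kQ̃′_k†c_kQ̃′_kG′_k`, (3.25)) and (HLb) the sup row with block decay of
# the covariant second difference `∇_UD_UG′_k` on `Δ̃(y′)`-localised Hölder data ((3.44)) — AND HENCE SO DOES THE (117) SOCKET FOR THE FULL `𝔊̃_k`** (§3, docking into
# G-3 by literal type); the localisation by this lineage's lattice partition of unity ((P) `B9Eq343BlockPartitionOfUnity`, (HJ-1) `B9Eq343BlockLocalisedHolderPieces`);
# NE9 crux-team LEAF PROVER 01, gen 92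

statement-level skeleton of published theorems with citation tags; proofs where landed; nothing here is a claim about the Yang–Mills mass gap

CITATION HEADER (lean-in-tree rule).  Audit cell `pub-balaban`, sub-cell `t4`, BINDER row NE9; filed by NE9 crux-team LEAF PROVER 01 (`b2b-balaban-t4-ne9-formalise-leaf-01`,
gen 92; bears_on: R4/N22).  Source READ first-hand this generation (`paper:balaban1985-cmp99-background-propagators`, journal page = PDF page + 388): pp. 394–395 (3.20)–(3.26),
397–398 (3.39)–(3.47) and Thm 3.1's text, 425–426 (3.146)–(3.153) and Thm 3.13.  COMPOSED BY NAME: G-1 `B9Eq3152GtildeThirdWordTwoSided.thirdWord_G1LatticeKPi_eq` (the third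
word is `D_UG′_kR_kG′_kD*_U`), (HJ-1) `B9Eq343BlockLocalisedHolderPieces.localised_pieces` (the pieces `ζ_y·ω` of the localisation), `B4Sect5Torus.torusSum_le` ∕
`B4Sect5Proof.latticeConst` (the re-summation over the blocks `y`), G-3 `B11Eq117FrakGkPiTransformationNorm.exists_norm_toCLM115_frakGkPi_le_of_thirdWord` (§3).  The two
Hölder members of Thm 3.1 enter as DISPLAYED `∃`-first HYPOTHESES of the exact shape a supplier on the cell's MODEL will prove (print proves them by the random walk of Sect. 3,
pp. 398–409; flat (3.43) exists kernel-checked on lit-balaban's torus-lineage carrier `B6Prop22HolderMultiLevelTorus`; flat (3.44) = [Balaban1984PropagatorsII] (2.138) as walk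
bookkeeping `B6Prop26HolderGrad2KLevelV1` with displayed legs; neither on the MODEL — this file does not change that).

THE CURRENCY (declared).  η-scale Hölder data of a site field `λ` are PLAIN pair differences `‖λ(x′) − λ(x)‖ ≤ H·(dist_{T}(x,x′)∕L^{n+1})^ε` on the pairs with
`dist_{T}(x, x′) ≤ L^{n+1}` (print's (3.40) «|x − x′| ≦ 1», `η = L^{−(n+1)}`, sup-distance `B4Sect5Torus.tdist`; print transports along `Γ_{x,x′}` — on the small-gauge
model the two quotients differ by a value-row term); block localisation `supp λ ⊂ Δ̃(y′)` is `λ(x) ≠ 0 ⟹ dist_{T_m}(Π(x), y′) ≤ 1`; weighted rows carry `e^{−δ·d_m(Π(x), v)}`.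

WHAT IS PROVED (sorry-free; proof lane — 0 `def`; [folklore] bookkeeping).
* §1 `sum_two_decays` (private) — `Σ_y e^{−δ_b d(w,y)}e^{−δ_a d(y,v)} ≤ K_d(δ_b − κ)·e^{−κ d(w,v)}`.
* §2 **`exists_local_gradLetter_thirdWord_of_holderLetters`** — (HLa) ∧ (HLb) ⟹ `H3`: `∃ (α₃, B₃, δ₃)` before (T4E)'s binder block such that for `f` supported over `Π⁻¹(v)`
  with `‖f‖_∞ ≤ F`, every `μ`, `b`: `‖(D_U(G̃_kD_UR_kD*_UG̃_kf)_μ)(b)‖ ≤ B₃·e^{−δ₃·d_m(Π(b₋),v)}·F` — by G-1 the word is `D_UG′_kω`, `ω = R_kG′_kD*_Uf`; (HLa) gives `ω`'s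
  weighted rows; `localised_pieces` splits `ω = Σ_y ζ_y·ω` into `Δ̃(y)`-localised pieces with value `B_aF·e^{δ_a}` and Hölder `(1+d)B_aF·e^{2δ_a}` constants times
  `e^{−δ_a d(y,v)}`; (HLb) bounds each piece's covariant second difference with `e^{−δ_b d(Π(b₋),y)}`; the slice-gradient is a linear functional of the site input
  (`map_sum`, `norm_sum_le`); re-summation by §1.  Constants: `α₃ = min(α_a, α_b)`, `δ₃ = min(δ_a, δ_b)∕2`, `B₃ = B_b·B_a·(e^{δ_a} + (1+d)e^{2δ_a})·K_d(δ_b − δ₃)`.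
* §3 **`exists_norm_toCLM115_frakGkPi_le_of_holderLetters`** — (HLa) ∧ (HLb) ⟹ G-3's (117) socket for the FULL `𝔊̃_k` (the junction's conclusion is `H3` by literal type).
HONEST SCOPE.  Composition BY NAME; the two Hölder letters are DISPLAYED, not supplied — after this file STOREY H = «(HLa) and (HLb) on the MODEL», i.e. the Hölder members
(3.43)₂ (through `R_k`'s landed sup ∕ gradient rows) and (3.44) of Thm 3.1 for `G′_k(U)`; `hpos′`, `hpos`, `hposπ`, `hQ`, the windows, `c₀ = η^d`, `‖J‖ ≤ α`∕`j₀` stay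
DISPLAYED; constants crude, NOT print's `B₀`, `B′₀(ε)`; nothing of [B9] Thm 3.1∕3.13 or [B11] (117) is asserted, valued or discharged; «NE9 ⇐ the named binders»; NE9 NOT
PRINTED ∕ NOT PROVED; row WALLED ON A MODEL (O-NE9-1; #5 UNRULED); spine PROVED 0∕9; rung (B)+1 on a finite T⁴ — NOT infinite volume, NOT mass gap, NOT BetaPertH, NOT Clay.
HONEST DEPENDENCY: continuum YM on T⁴ ⇐ BetaPertH ∧ nine spine estimates (0/9 proved); BetaPertH ⇐ (D1) ∧ (D4) ∧ CAP+tail; G-an2-4 gates asym, D1 and NE2/3/4.  NEW file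
importing G-1, (HJ-1), G-3; nothing modified.  Net new unproved facts: 0.
-/

noncomputable section

set_option autoImplicit false

open scoped InnerProductSpace ComplexConjugate BigOperators

namespace Literature.MathematicalPhysics.QuantumFieldTheory.Balaban1983to89.B9Eq3152ThirdWordPiGradRowOfHolderLetters

open B4Sect5Torus (TSite tdist tdist_nonneg tdist_triangle tdist_symm torusSum_le)
open B4Sect5Proof (latticeConst latticeConst_nonneg)
open B9SectCLatticeCarrier (Bond bpos btgt unshift)
open B9Eq311L2Pairing (WL2)
open B9Eq319QprimeTorus (fineP blockCoord)
open B7Prop1Explicit (U1 Wcx boxVec)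
open B11Eq103H1Complex (SiteL2K BondL2K covDerivL2K covDivL2K G1LatticeK)
open B9Eq310DeltaPrime (plaqHolU)
open B9Eq310HessianOperator (adTransportW hessOp)
open B9Eq315QTorus (perCfg cornerSite)
open B9Eq315QTower (towerP UlevOf)
open B9Eq316TowerFlatIsOneStep (towerP_eq_fineP_pow siteCast)
open B9Eq326OperatorTower (QprimeTowerW QkW RofUk laplaceAk G1k)
open B9Eq324DeltaPrimeATower (laplacePrimeAk GpOfUk)
open B9Eq3119DeltaPiTower (piOfUk laplaceAkPi)
open B9Eq3152GtildeThirdWordTwoSided (thirdWord_G1LatticeKPi_eq)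
open B9Eq343BlockPartitionOfUnity (blockPartition)
open B9Eq343BlockLocalisedHolderPieces (localised_pieces)

variable {d : ℕ} (L : ℕ) [NeZero L] (hL : 1 ≤ L)
  {𝔸 : Type*} [NormedRing 𝔸] [NormedAlgebra ℂ 𝔸] [CompleteSpace 𝔸] [NormOneClass 𝔸] [StarRing 𝔸] [StarModule ℂ 𝔸]
  {W : Type*} [NormedAddCommGroup W] [InnerProductSpace ℂ W] [FiniteDimensional ℂ W] (φ : W ≃ₗ[ℂ] 𝔸)
  {a : ℝ} {a' : ℝ} {ϱ : ℝ}
  (τ : 𝔸 →ₗ[ℂ] ℂ) {ρw : ℝ}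
  (hτ₁ : ∀ X : 𝔸, τ (star X) = conj (τ X)) (hτ₂ : ∀ X Y : 𝔸, τ (X * Y) = τ (Y * X)) (hφτ : ∀ X Y : 𝔸, ⟪φ.symm X, φ.symm Y⟫_ℂ = τ (star X * Y))
  (AQ : ℝ)

omit [NeZero L] in
/-- sums of two decays: `Σ_y e^{−δb·d(w,y)}·e^{−δa·d(y,v)} ≤ K_d(δb − κ)·e^{−κ·d(w,v)}` for `0 ≤ κ ≤ δa`, `κ < δb` (the convolution step of `letter_comp`). [folklore] -/
private theorem sum_two_decays {m : Fin d → ℕ} [∀ i, NeZero (m i)] (hm : ∀ i, 1 ≤ m i) {δa δb κ : ℝ} (hκa : κ ≤ δa) (hκb : κ < δb) (hκ0 : 0 ≤ κ)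
    (w v : TSite d m) :
    ∑ y, Real.exp (-(δb * tdist m w y)) * Real.exp (-(δa * tdist m y v)) ≤ latticeConst d (δb - κ) * Real.exp (-(κ * tdist m w v)) := by
  have hS := torusSum_le d hm (sub_pos.2 hκb) w
  calc ∑ y, Real.exp (-(δb * tdist m w y)) * Real.exp (-(δa * tdist m y v))
      ≤ ∑ y, Real.exp (-((δb - κ) * tdist m w y)) * Real.exp (-(κ * tdist m w v)) := by
        refine Finset.sum_le_sum fun y _ => ?_
        rw [← Real.exp_add, ← Real.exp_add]
        refine Real.exp_le_exp.2 ?_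
        have h1 := tdist_triangle hm w y v
        have h2 := tdist_nonneg m y v
        have h3 := tdist_nonneg m w y
        nlinarith [mul_le_mul_of_nonneg_left h1 hκ0, mul_le_mul_of_nonneg_right hκa h2]
    _ = (∑ y, Real.exp (-((δb - κ) * tdist m w y))) * Real.exp (-(κ * tdist m w v)) := by rw [Finset.sum_mul]
    _ ≤ latticeConst d (δb - κ) * Real.exp (-(κ * tdist m w v)) := mul_le_mul_of_nonneg_right hS (Real.exp_nonneg _)

set_option maxHeartbeats 800000 in -- three ≈ 50-binder blocks (two displayed letters + the conclusion) and the pieces' bookkeeping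
include hL hτ₁ hτ₂ hφτ in
/-- **STOREY H REDUCED TO PRINT: the local slice-gradient row `H3` of the third word `G̃_kD_UR_kD*_UG̃_k` of `𝔊̃_k` FROM the two Hölder letters of
Thm 3.1 for `G′_k(U)`** — (HLa): weighted value ∕ η-scale Hölder rows of `ω = R_kG′_kD*_Uf` for block-supported sup data `f` ((3.43)₂ + `R_k`'s rows); (HLb): for every
`0 < ε ≤ 1`, the sup row with block decay of the covariant second difference `(D_U(D_UG′_kλ)_μ)(b)` on `Δ̃(y′)`-localised data with value bound `N` and η-scale
ε-Hölder bound `H` ((3.44), both derivatives on the left — print: «the choice of derivatives ∇_U, ∇*_U is conventional»).  Proof: G-1, `localised_pieces`, linearity,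
`sum_two_decays`. [cite: Balaban1985BackgroundPropagators, Thm 3.13 p.426, Thm 3.1 (3.42)–(3.44) pp.397–398, (3.40) p.397, (3.152)–(3.153) p.426, (3.25) p.394]
[cite: Balaban1985Variational, (117) p.295] -/
theorem exists_local_gradLetter_thirdWord_of_holderLetters
    (HLa : ∃ ε αa Ba δa : ℝ, 0 < ε ∧ ε ≤ 1 ∧ 0 < αa ∧ 0 ≤ Ba ∧ 0 < δa ∧
      ∀ (n : ℕ) (η : ℝ) (_hηL : η * (L : ℝ) ^ (n + 1) = 1) (c₀ c₁ : ℝ) [Fact (0 < c₀)] [Fact (0 < c₁)]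
        (_hw : c₀ * ((L : ℝ) ^ (n + 1)) ^ d = c₁) (_hρ : |η| ^ d / c₀ ≤ ρw) (m : Fin d → ℕ) [∀ i, NeZero (m i)] (_hm : ∀ i, 1 ≤ m i)
        (U : Bond d (towerP L m (n + 1)) → 𝔸ˣ) (αU : ℕ → ℝ) (_hα0 : ∀ j, 0 ≤ αU j) (hα1 : ∀ j, αU j ≤ 1 / 64)
        (hU1 : ∀ (j : ℕ) (x : B7Prop1Explicit.Site d) (k : Fin d), perCfg (towerP L m (j + 1)) (UlevOf L m (n + 1) U j) x k ∈ U1 𝔸)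
        (hreg : ∀ (j : ℕ) (y : TSite d (towerP L m j)) (k : Fin d) (ρ' : Fin d → Fin L),
          ‖((Wcx L (perCfg (towerP L m (j + 1)) (UlevOf L m (n + 1) U j)) (cornerSite L y) k (boxVec L ρ') : 𝔸ˣ) : 𝔸) - 1‖ ≤ αU j)
        (εU : ℕ → ℝ) (_hεU : ∀ j, 0 ≤ εU j) (_hUε : ∀ (j : ℕ) (b : Bond d (towerP L m (j + 1))), ‖(UlevOf L m (n + 1) U j b : 𝔸) - 1‖ ≤ εU j)
        (_hLb : ∀ (j : ℕ) (b : Bond d (towerP L m (j + 1))), UlevOf L m (n + 1) U j b ∈ U1 𝔸)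
        (α : ℝ) (_hα : 0 ≤ α) (_hαle : α ≤ αa)
        (hUst : ∀ b, star (U b : 𝔸) = (((U b)⁻¹ : 𝔸ˣ) : 𝔸)) (_hUb : ∀ b, U b ∈ U1 𝔸) (_hUη : ∀ b, ‖(U b : 𝔸) - 1‖ ≤ α * η)
        (_hpl : ∀ p : B9SectCLatticeCarrier.Plaq d (towerP L m (n + 1)), ‖(plaqHolU U p : 𝔸) - 1‖ ≤ α * η ^ 2)
        (_hUgrad : ∀ (x : TSite d (towerP L m (n + 1))) (μ : Fin d), ‖(U (x, μ) : 𝔸) - U (unshift μ x, μ)‖ ≤ α * η ^ 2)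
        (_hRlev : ∀ (j : ℕ) (b : Bond d (towerP L m (j + 1))) (w : W), ‖adTransportW φ (UlevOf L m (n + 1) U j) b w‖ ≤ ‖w‖)
        (_hεg : ∀ j < n + 1, εU j ≤ α * ϱ ^ j) (_hAQ : ∑ j ∈ Finset.range (n + 1), αU j ≤ AQ)
        (hpos' : ∀ x : SiteL2K ℂ d (towerP L m (n + 1)) c₀ W, x ≠ 0 → 0 < RCLike.re ⟪x, laplacePrimeAk L m n φ η U a' (c₁ := c₁) x⟫_ℂ)
        (hpos : ∀ x : BondL2K ℂ d (towerP L m (n + 1)) c₀ W, x ≠ 0 →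
          0 < RCLike.re ⟪x, laplaceAk L m n φ η U hL αU hα1 hU1 hreg τ (c₀ := c₀) (c₁ := c₁) a x⟫_ℂ)
        (hposπ : ∀ x : BondL2K ℂ d (towerP L m (n + 1)) c₀ W, x ≠ 0 →
          0 < RCLike.re ⟪x, laplaceAkPi L m n φ τ η U a' hpos' hL αU hα1 hU1 hreg (c₁ := c₁) a x⟫_ℂ)
        (_hc₀ : c₀ = η ^ d)
        (_hJ : ∀ (μ : Fin d) (y : TSite d (towerP L m (n + 1))),
          ‖B9Eq39Adjoint.J (fun μ => B9Eq33CovDerivVector.shiftEquiv μ) (fun μ y => U (y, μ)) η μ y‖ ≤ α)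
        (v : TSite d m) (f : BondL2K ℂ d (towerP L m (n + 1)) c₀ W) (F : ℝ)
        (_hfv : ∀ b, blockCoord (L ^ (n + 1)) m (siteCast (towerP_eq_fineP_pow L m (n + 1)) (bpos b)) ≠ v →
          WL2.equiv ℂ (fun _ : Bond d (towerP L m (n + 1)) => c₀) W f b = 0)
        (_hfF : ∀ b, ‖WL2.equiv ℂ (fun _ : Bond d (towerP L m (n + 1)) => c₀) W f b‖ ≤ F) (x : TSite d (towerP L m (n + 1))),
        ‖WL2.equiv ℂ (fun _ : TSite d (towerP L m (n + 1)) => c₀) W (RofUk L m n φ η U (GpOfUk L m n φ η U a' (c₁ := c₁) hpos' (covDivL2K ℂ c₀ ((η : ℂ))⁻¹ (adTransportW φ fun bb => (U bb)⁻¹) f))) x‖ ≤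
          Ba * Real.exp (-(δa * tdist m (blockCoord (L ^ (n + 1)) m (siteCast (towerP_eq_fineP_pow L m (n + 1)) x)) v)) * F ∧
        ∀ x' : TSite d (towerP L m (n + 1)), tdist (towerP L m (n + 1)) x x' ≤ ((L ^ (n + 1) : ℕ) : ℝ) →
          ‖WL2.equiv ℂ (fun _ : TSite d (towerP L m (n + 1)) => c₀) W (RofUk L m n φ η U (GpOfUk L m n φ η U a' (c₁ := c₁) hpos' (covDivL2K ℂ c₀ ((η : ℂ))⁻¹ (adTransportW φ fun bb => (U bb)⁻¹) f))) x' - WL2.equiv ℂ (fun _ : TSite d (towerP L m (n + 1)) => c₀) W (RofUk L m n φ η U (GpOfUk L m n φ η U a' (c₁ := c₁) hpos' (covDivL2K ℂ c₀ ((η : ℂ))⁻¹ (adTransportW φ fun bb => (U bb)⁻¹) f))) x‖ ≤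
            Ba * Real.exp (-(δa * tdist m (blockCoord (L ^ (n + 1)) m (siteCast (towerP_eq_fineP_pow L m (n + 1)) x)) v)) * (tdist (towerP L m (n + 1)) x x' / ((L ^ (n + 1) : ℕ) : ℝ)) ^ ε * F)
    (HLb : ∀ ε : ℝ, 0 < ε → ε ≤ 1 → ∃ αb Bb δb : ℝ, 0 < αb ∧ 0 ≤ Bb ∧ 0 < δb ∧
      ∀ (n : ℕ) (η : ℝ) (_hηL : η * (L : ℝ) ^ (n + 1) = 1) (c₀ c₁ : ℝ) [Fact (0 < c₀)] [Fact (0 < c₁)]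
        (_hw : c₀ * ((L : ℝ) ^ (n + 1)) ^ d = c₁) (_hρ : |η| ^ d / c₀ ≤ ρw) (m : Fin d → ℕ) [∀ i, NeZero (m i)] (_hm : ∀ i, 1 ≤ m i)
        (U : Bond d (towerP L m (n + 1)) → 𝔸ˣ) (αU : ℕ → ℝ) (_hα0 : ∀ j, 0 ≤ αU j) (hα1 : ∀ j, αU j ≤ 1 / 64)
        (hU1 : ∀ (j : ℕ) (x : B7Prop1Explicit.Site d) (k : Fin d), perCfg (towerP L m (j + 1)) (UlevOf L m (n + 1) U j) x k ∈ U1 𝔸)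
        (hreg : ∀ (j : ℕ) (y : TSite d (towerP L m j)) (k : Fin d) (ρ' : Fin d → Fin L),
          ‖((Wcx L (perCfg (towerP L m (j + 1)) (UlevOf L m (n + 1) U j)) (cornerSite L y) k (boxVec L ρ') : 𝔸ˣ) : 𝔸) - 1‖ ≤ αU j)
        (εU : ℕ → ℝ) (_hεU : ∀ j, 0 ≤ εU j) (_hUε : ∀ (j : ℕ) (b : Bond d (towerP L m (j + 1))), ‖(UlevOf L m (n + 1) U j b : 𝔸) - 1‖ ≤ εU j)
        (_hLb : ∀ (j : ℕ) (b : Bond d (towerP L m (j + 1))), UlevOf L m (n + 1) U j b ∈ U1 𝔸)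
        (α : ℝ) (_hα : 0 ≤ α) (_hαle : α ≤ αb)
        (hUst : ∀ b, star (U b : 𝔸) = (((U b)⁻¹ : 𝔸ˣ) : 𝔸)) (_hUb : ∀ b, U b ∈ U1 𝔸) (_hUη : ∀ b, ‖(U b : 𝔸) - 1‖ ≤ α * η)
        (_hpl : ∀ p : B9SectCLatticeCarrier.Plaq d (towerP L m (n + 1)), ‖(plaqHolU U p : 𝔸) - 1‖ ≤ α * η ^ 2)
        (_hUgrad : ∀ (x : TSite d (towerP L m (n + 1))) (μ : Fin d), ‖(U (x, μ) : 𝔸) - U (unshift μ x, μ)‖ ≤ α * η ^ 2)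
        (_hRlev : ∀ (j : ℕ) (b : Bond d (towerP L m (j + 1))) (w : W), ‖adTransportW φ (UlevOf L m (n + 1) U j) b w‖ ≤ ‖w‖)
        (_hεg : ∀ j < n + 1, εU j ≤ α * ϱ ^ j) (_hAQ : ∑ j ∈ Finset.range (n + 1), αU j ≤ AQ)
        (hpos' : ∀ x : SiteL2K ℂ d (towerP L m (n + 1)) c₀ W, x ≠ 0 → 0 < RCLike.re ⟪x, laplacePrimeAk L m n φ η U a' (c₁ := c₁) x⟫_ℂ)
        (hpos : ∀ x : BondL2K ℂ d (towerP L m (n + 1)) c₀ W, x ≠ 0 →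
          0 < RCLike.re ⟪x, laplaceAk L m n φ η U hL αU hα1 hU1 hreg τ (c₀ := c₀) (c₁ := c₁) a x⟫_ℂ)
        (hposπ : ∀ x : BondL2K ℂ d (towerP L m (n + 1)) c₀ W, x ≠ 0 →
          0 < RCLike.re ⟪x, laplaceAkPi L m n φ τ η U a' hpos' hL αU hα1 hU1 hreg (c₁ := c₁) a x⟫_ℂ)
        (_hc₀ : c₀ = η ^ d)
        (_hJ : ∀ (μ : Fin d) (y : TSite d (towerP L m (n + 1))),
          ‖B9Eq39Adjoint.J (fun μ => B9Eq33CovDerivVector.shiftEquiv μ) (fun μ y => U (y, μ)) η μ y‖ ≤ α)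
        (y' : TSite d m) (lam : SiteL2K ℂ d (towerP L m (n + 1)) c₀ W) (N H : ℝ) (_hN : 0 ≤ N) (_hH : 0 ≤ H)
        (_hsupp : ∀ x, WL2.equiv ℂ (fun _ : TSite d (towerP L m (n + 1)) => c₀) W lam x ≠ 0 → tdist m (blockCoord (L ^ (n + 1)) m (siteCast (towerP_eq_fineP_pow L m (n + 1)) x)) y' ≤ 1)
        (_hval : ∀ x, ‖WL2.equiv ℂ (fun _ : TSite d (towerP L m (n + 1)) => c₀) W lam x‖ ≤ N)
        (_hhol : ∀ x x' : TSite d (towerP L m (n + 1)), tdist (towerP L m (n + 1)) x x' ≤ ((L ^ (n + 1) : ℕ) : ℝ) →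
          ‖WL2.equiv ℂ (fun _ : TSite d (towerP L m (n + 1)) => c₀) W lam x' - WL2.equiv ℂ (fun _ : TSite d (towerP L m (n + 1)) => c₀) W lam x‖ ≤ H * (tdist (towerP L m (n + 1)) x x' / ((L ^ (n + 1) : ℕ) : ℝ)) ^ ε)
        (μ : Fin d) (b : Bond d (towerP L m (n + 1))),
        ‖WL2.equiv ℂ (fun _ : Bond d (towerP L m (n + 1)) => c₀) W (covDerivL2K ℂ c₀ ((η : ℂ))⁻¹ (adTransportW φ U)
            ((WL2.equiv ℂ (fun _ : TSite d (towerP L m (n + 1)) => c₀) W).symm fun y => WL2.equiv ℂ (fun _ : Bond d (towerP L m (n + 1)) => c₀) W (covDerivL2K ℂ c₀ ((η : ℂ))⁻¹ (adTransportW φ U) (GpOfUk L m n φ η U a' (c₁ := c₁) hpos' lam)) (y, μ))) b‖ ≤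
          Bb * Real.exp (-(δb * tdist m (blockCoord (L ^ (n + 1)) m (siteCast (towerP_eq_fineP_pow L m (n + 1)) (bpos b))) y')) * (N + H)) :
    ∃ α₃ B₃ δ₃ : ℝ, 0 < α₃ ∧ 0 ≤ B₃ ∧ 0 < δ₃ ∧
      ∀ (n : ℕ) (η : ℝ) (_hηL : η * (L : ℝ) ^ (n + 1) = 1) (c₀ c₁ : ℝ) [Fact (0 < c₀)] [Fact (0 < c₁)]
        (_hw : c₀ * ((L : ℝ) ^ (n + 1)) ^ d = c₁) (_hρ : |η| ^ d / c₀ ≤ ρw) (m : Fin d → ℕ) [∀ i, NeZero (m i)] (_hm : ∀ i, 1 ≤ m i)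
        (U : Bond d (towerP L m (n + 1)) → 𝔸ˣ) (αU : ℕ → ℝ) (_hα0 : ∀ j, 0 ≤ αU j) (hα1 : ∀ j, αU j ≤ 1 / 64)
        (hU1 : ∀ (j : ℕ) (x : B7Prop1Explicit.Site d) (k : Fin d), perCfg (towerP L m (j + 1)) (UlevOf L m (n + 1) U j) x k ∈ U1 𝔸)
        (hreg : ∀ (j : ℕ) (y : TSite d (towerP L m j)) (k : Fin d) (ρ' : Fin d → Fin L),
          ‖((Wcx L (perCfg (towerP L m (j + 1)) (UlevOf L m (n + 1) U j)) (cornerSite L y) k (boxVec L ρ') : 𝔸ˣ) : 𝔸) - 1‖ ≤ αU j)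
        (εU : ℕ → ℝ) (_hεU : ∀ j, 0 ≤ εU j) (_hUε : ∀ (j : ℕ) (b : Bond d (towerP L m (j + 1))), ‖(UlevOf L m (n + 1) U j b : 𝔸) - 1‖ ≤ εU j)
        (_hLb : ∀ (j : ℕ) (b : Bond d (towerP L m (j + 1))), UlevOf L m (n + 1) U j b ∈ U1 𝔸)
        (α : ℝ) (_hα : 0 ≤ α) (_hαle : α ≤ α₃)
        (hUst : ∀ b, star (U b : 𝔸) = (((U b)⁻¹ : 𝔸ˣ) : 𝔸)) (_hUb : ∀ b, U b ∈ U1 𝔸) (_hUη : ∀ b, ‖(U b : 𝔸) - 1‖ ≤ α * η)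
        (_hpl : ∀ p : B9SectCLatticeCarrier.Plaq d (towerP L m (n + 1)), ‖(plaqHolU U p : 𝔸) - 1‖ ≤ α * η ^ 2)
        (_hUgrad : ∀ (x : TSite d (towerP L m (n + 1))) (μ : Fin d), ‖(U (x, μ) : 𝔸) - U (unshift μ x, μ)‖ ≤ α * η ^ 2)
        (_hRlev : ∀ (j : ℕ) (b : Bond d (towerP L m (j + 1))) (w : W), ‖adTransportW φ (UlevOf L m (n + 1) U j) b w‖ ≤ ‖w‖)
        (_hεg : ∀ j < n + 1, εU j ≤ α * ϱ ^ j) (_hAQ : ∑ j ∈ Finset.range (n + 1), αU j ≤ AQ)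
        (hpos' : ∀ x : SiteL2K ℂ d (towerP L m (n + 1)) c₀ W, x ≠ 0 → 0 < RCLike.re ⟪x, laplacePrimeAk L m n φ η U a' (c₁ := c₁) x⟫_ℂ)
        (hpos : ∀ x : BondL2K ℂ d (towerP L m (n + 1)) c₀ W, x ≠ 0 →
          0 < RCLike.re ⟪x, laplaceAk L m n φ η U hL αU hα1 hU1 hreg τ (c₀ := c₀) (c₁ := c₁) a x⟫_ℂ)
        (hposπ : ∀ x : BondL2K ℂ d (towerP L m (n + 1)) c₀ W, x ≠ 0 →
          0 < RCLike.re ⟪x, laplaceAkPi L m n φ τ η U a' hpos' hL αU hα1 hU1 hreg (c₁ := c₁) a x⟫_ℂ)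
        (_hc₀ : c₀ = η ^ d)
        (_hJ : ∀ (μ : Fin d) (y : TSite d (towerP L m (n + 1))),
          ‖B9Eq39Adjoint.J (fun μ => B9Eq33CovDerivVector.shiftEquiv μ) (fun μ y => U (y, μ)) η μ y‖ ≤ α)
        (v : TSite d m) (f : BondL2K ℂ d (towerP L m (n + 1)) c₀ W) (F : ℝ)
        (_hfv : ∀ b, blockCoord (L ^ (n + 1)) m (siteCast (towerP_eq_fineP_pow L m (n + 1)) (bpos b)) ≠ v →
          WL2.equiv ℂ (fun _ : Bond d (towerP L m (n + 1)) => c₀) W f b = 0)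
        (_hfF : ∀ b, ‖WL2.equiv ℂ (fun _ : Bond d (towerP L m (n + 1)) => c₀) W f b‖ ≤ F) (μ : Fin d) (b : Bond d (towerP L m (n + 1))),
        ‖WL2.equiv ℂ (fun _ : Bond d (towerP L m (n + 1)) => c₀) W (covDerivL2K ℂ c₀ ((η : ℂ))⁻¹ (adTransportW φ U)
            ((WL2.equiv ℂ (fun _ : TSite d (towerP L m (n + 1)) => c₀) W).symm fun y =>
              WL2.equiv ℂ (fun _ : Bond d (towerP L m (n + 1)) => c₀) W
                (G1LatticeK hposπ (covDerivL2K ℂ c₀ ((η : ℂ))⁻¹ (adTransportW φ U) (RofUk L m n φ η U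
                  (covDivL2K ℂ c₀ ((η : ℂ))⁻¹ (adTransportW φ fun bb => (U bb)⁻¹) (G1LatticeK hposπ f))))) (y, μ))) b‖ ≤
          B₃ * Real.exp (-(δ₃ * tdist m (blockCoord (L ^ (n + 1)) m (siteCast (towerP_eq_fineP_pow L m (n + 1)) (bpos b))) v)) * F := by
  classical
  obtain ⟨ε, αa, Ba, δa, hε0, hε1, hαa, hBa, hδa, HA⟩ := HLa
  obtain ⟨αb, Bb, δb, hαb, hBb, hδb, HB⟩ := HLb ε hε0 hε1
  obtain ⟨κ, hκd⟩ : ∃ κ : ℝ, κ = min δa δb / 2 := ⟨_, rfl⟩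
  have hκ0 : 0 < κ := by rw [hκd]; exact half_pos (lt_min hδa hδb)
  have hκa : κ ≤ δa := by rw [hκd]; linarith [min_le_left δa δb, (lt_min hδa hδb).le]
  have hκb : κ < δb := by rw [hκd]; linarith [min_le_right δa δb, lt_min hδa hδb]
  have hKc : 0 ≤ latticeConst d (δb - κ) := latticeConst_nonneg d (by linarith)
  obtain ⟨C, hC⟩ : ∃ C : ℝ, C = Bb * (Ba * Real.exp δa + (Ba + d * Ba) * Real.exp (2 * δa)) * latticeConst d (δb - κ) := ⟨_, rfl⟩
  have hC0 : 0 ≤ C := by rw [hC]; positivity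
  refine ⟨min αa αb, C, κ, lt_min hαa hαb, hC0, hκ0, ?_⟩
  intro n η hηL c₀ c₁ _ _ hw hρ m _ hm U αU hα0 hα1 hU1 hreg εU hεU hUε hLb α hα hαle hUst hUb hUη hpl hUgrad hRlev hεg hAQ hpos' hpos hposπ hc₀ hJ v f F hfv hfF μ b
  have hαa' : α ≤ αa := hαle.trans (min_le_left _ _)
  have hαb' : α ≤ αb := hαle.trans (min_le_right _ _)
  have hF0 : 0 ≤ F := (norm_nonneg _).trans (hfF b)
  haveI : NeZero (L ^ (n + 1)) := ⟨pow_ne_zero _ (NeZero.ne L)⟩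
  have HAk := HA n η hηL c₀ c₁ hw hρ m hm U αU hα0 hα1 hU1 hreg εU hεU hUε hLb α hα hαa' hUst hUb hUη hpl hUgrad hRlev hεg hAQ hpos' hpos hposπ hc₀ hJ v f F hfv hfF
  have HBk := HB n η hηL c₀ c₁ hw hρ m hm U αU hα0 hα1 hU1 hreg εU hεU hUε hLb α hα hαb' hUst hUb hUη hpl hUgrad hRlev hεg hAQ hpos' hpos hposπ hc₀ hJ
  -- the third word is `D_U G′_k ω`, `ω = R_k G′_k D*_U f` (G-1)
  rw [thirdWord_G1LatticeKPi_eq L m n φ τ hτ₁ hτ₂ hφτ η U hUst a' hpos' hL αU hα1 hU1 hreg a hposπ f]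
  set ω : SiteL2K ℂ d (towerP L m (n + 1)) c₀ W := RofUk L m n φ η U (GpOfUk L m n φ η U a' (c₁ := c₁) hpos' (covDivL2K ℂ c₀ ((η : ℂ))⁻¹ (adTransportW φ fun bb => (U bb)⁻¹) f)) with hω
  -- the pieces of `ω`
  have hP := localised_pieces (W := W) (L ^ (n + 1)) m (towerP_eq_fineP_pow L m (n + 1)) hm
    (WL2.equiv ℂ (fun _ : TSite d (towerP L m (n + 1)) => c₀) W ω) v (N := Ba * F) (H := Ba * F) (δ := δa) (ε := ε)
    (by positivity) (by positivity) hδa.le hε1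
    (fun x => by
      have h1 := (HAk x).1
      have e1 : Ba * Real.exp (-(δa * tdist m (blockCoord (L ^ (n + 1)) m (siteCast (towerP_eq_fineP_pow L m (n + 1)) x)) v)) * F =
        Ba * F * Real.exp (-(δa * tdist m (blockCoord (L ^ (n + 1)) m (siteCast (towerP_eq_fineP_pow L m (n + 1)) x)) v)) := by ring
      rw [← e1]; exact h1)
    (fun x x' hxx => by
      have h1 := (HAk x).2 x' hxx
      have e1 : Ba * Real.exp (-(δa * tdist m (blockCoord (L ^ (n + 1)) m (siteCast (towerP_eq_fineP_pow L m (n + 1)) x)) v)) * (tdist (towerP L m (n + 1)) x x' / ((L ^ (n + 1) : ℕ) : ℝ)) ^ ε * F =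
        Ba * F * Real.exp (-(δa * tdist m (blockCoord (L ^ (n + 1)) m (siteCast (towerP_eq_fineP_pow L m (n + 1)) x)) v)) * (tdist (towerP L m (n + 1)) x x' / ((L ^ (n + 1) : ℕ) : ℝ)) ^ ε := by ring
      rw [← e1]; exact h1)
  obtain ⟨hsum, hsupp, hval, hhol⟩ := hP
  -- the pieces as elements of the `L²` carrier
  set lam : TSite d m → SiteL2K ℂ d (towerP L m (n + 1)) c₀ W := fun y =>
    (WL2.equiv ℂ (fun _ : TSite d (towerP L m (n + 1)) => c₀) W).symm fun x => ((blockPartition (L ^ (n + 1)) m y (siteCast (towerP_eq_fineP_pow L m (n + 1)) x) : ℝ) : ℂ) • WL2.equiv ℂ (fun _ : TSite d (towerP L m (n + 1)) => c₀) W ω x with hlam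
  have hlam_apply : ∀ y x, WL2.equiv ℂ (fun _ : TSite d (towerP L m (n + 1)) => c₀) W (lam y) x =
      ((blockPartition (L ^ (n + 1)) m y (siteCast (towerP_eq_fineP_pow L m (n + 1)) x) : ℝ) : ℂ) • WL2.equiv ℂ (fun _ : TSite d (towerP L m (n + 1)) => c₀) W ω x := fun _ _ => rfl
  have hωsum : ω = ∑ y, lam y := by
    apply (WL2.linearEquiv ℂ ℂ (fun _ : TSite d (towerP L m (n + 1)) => c₀)).injective
    rw [map_sum]
    funext x
    rw [Finset.sum_apply]
    simp only [WL2.linearEquiv_apply, hlam_apply]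
    exact (hsum x).symm
  -- the slice-gradient of `D_U G′_k s` at `(b, μ)` as a linear functional of the site input `s`
  obtain ⟨Φ, hΦ⟩ : ∃ Φ : SiteL2K ℂ d (towerP L m (n + 1)) c₀ W →ₗ[ℂ] W, ∀ s, Φ s =
      WL2.equiv ℂ (fun _ : Bond d (towerP L m (n + 1)) => c₀) W (covDerivL2K ℂ c₀ ((η : ℂ))⁻¹ (adTransportW φ U)
        ((WL2.equiv ℂ (fun _ : TSite d (towerP L m (n + 1)) => c₀) W).symm fun y => WL2.equiv ℂ (fun _ : Bond d (towerP L m (n + 1)) => c₀) W (covDerivL2K ℂ c₀ ((η : ℂ))⁻¹ (adTransportW φ U) (GpOfUk L m n φ η U a' (c₁ := c₁) hpos' s)) (y, μ))) b :=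
    ⟨(LinearMap.proj b : (Bond d (towerP L m (n + 1)) → W) →ₗ[ℂ] W) ∘ₗ
      (WL2.linearEquiv ℂ ℂ (fun _ : Bond d (towerP L m (n + 1)) => c₀)).toLinearMap ∘ₗ
      covDerivL2K ℂ c₀ ((η : ℂ))⁻¹ (adTransportW φ U) ∘ₗ
      (WL2.linearEquiv ℂ ℂ (fun _ : TSite d (towerP L m (n + 1)) => c₀)).symm.toLinearMap ∘ₗ
      LinearMap.funLeft ℂ W (fun y' : TSite d (towerP L m (n + 1)) => ((y', μ) : Bond d (towerP L m (n + 1)))) ∘ₗ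
      (WL2.linearEquiv ℂ ℂ (fun _ : Bond d (towerP L m (n + 1)) => c₀)).toLinearMap ∘ₗ
      covDerivL2K ℂ c₀ ((η : ℂ))⁻¹ (adTransportW φ U) ∘ₗ GpOfUk L m n φ η U a' (c₁ := c₁) hpos', fun _ => rfl⟩
  rw [← hΦ, hωsum, map_sum]
  refine (norm_sum_le _ _).trans ?_
  -- each piece through the displayed (3.44)-letter
  have hpiece : ∀ y, ‖Φ (lam y)‖ ≤ Bb * Real.exp (-(δb * tdist m (blockCoord (L ^ (n + 1)) m (siteCast (towerP_eq_fineP_pow L m (n + 1)) (bpos b))) y)) *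
      (Ba * F * Real.exp δa * Real.exp (-(δa * tdist m y v)) + (Ba * F + d * (Ba * F)) * Real.exp (2 * δa) * Real.exp (-(δa * tdist m y v))) := by
    intro y
    rw [hΦ]
    exact HBk y (lam y) _ _ (by positivity) (by positivity) (fun x hx => hsupp y x (by rw [hlam_apply] at hx; exact hx))
      (fun x => by rw [hlam_apply]; exact hval y x) (fun x x' hxx => by rw [hlam_apply, hlam_apply]; exact hhol y x x' hxx) μ b
  refine (Finset.sum_le_sum fun y _ => hpiece y).trans ?_
  have hsum2 := sum_two_decays hm hκa hκb hκ0.le (blockCoord (L ^ (n + 1)) m (siteCast (towerP_eq_fineP_pow L m (n + 1)) (bpos b))) v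
  have e : ∀ y, Bb * Real.exp (-(δb * tdist m (blockCoord (L ^ (n + 1)) m (siteCast (towerP_eq_fineP_pow L m (n + 1)) (bpos b))) y)) *
      (Ba * F * Real.exp δa * Real.exp (-(δa * tdist m y v)) + (Ba * F + d * (Ba * F)) * Real.exp (2 * δa) * Real.exp (-(δa * tdist m y v))) =
      Bb * (Ba * Real.exp δa + (Ba + d * Ba) * Real.exp (2 * δa)) * F *
        (Real.exp (-(δb * tdist m (blockCoord (L ^ (n + 1)) m (siteCast (towerP_eq_fineP_pow L m (n + 1)) (bpos b))) y)) * Real.exp (-(δa * tdist m y v))) := fun y => by ring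
  simp_rw [e, ← Finset.mul_sum]
  have h0 : 0 ≤ Bb * (Ba * Real.exp δa + (Ba + d * Ba) * Real.exp (2 * δa)) * F := by positivity
  calc Bb * (Ba * Real.exp δa + (Ba + d * Ba) * Real.exp (2 * δa)) * F *
        ∑ y, Real.exp (-(δb * tdist m (blockCoord (L ^ (n + 1)) m (siteCast (towerP_eq_fineP_pow L m (n + 1)) (bpos b))) y)) * Real.exp (-(δa * tdist m y v))
      ≤ Bb * (Ba * Real.exp δa + (Ba + d * Ba) * Real.exp (2 * δa)) * F *
        (latticeConst d (δb - κ) * Real.exp (-(κ * tdist m (blockCoord (L ^ (n + 1)) m (siteCast (towerP_eq_fineP_pow L m (n + 1)) (bpos b))) v))) := mul_le_mul_of_nonneg_left hsum2 h0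
    _ = C * Real.exp (-(κ * tdist m (blockCoord (L ^ (n + 1)) m (siteCast (towerP_eq_fineP_pow L m (n + 1)) (bpos b))) v)) * F := by rw [hC]; ring

/-! ## §3 Docking into the (117) socket: `‖toCLM115 ∇_U 𝔊̃_k‖` from the two Hölder letters -/

section Socket

open B9Eq33CovDerivVector (covGrad)
open B11Eq103H1Complex (frakGLatticeK)
open B11Eq115Space (NegSup levWeight)
open B11Eq111FrakG (toCLM115)
open B11Eq117FrakGkPiTransformationNorm (exists_norm_toCLM115_frakGkPi_le_of_thirdWord)

variable (hd : 1 ≤ d) (hL3 : 3 ≤ L) [NormedStarGroup 𝔸]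
  {Mφ Mφ' : ℝ} (hMφ : 0 ≤ Mφ) (hMφ' : 0 ≤ Mφ') (hφ : ∀ w, ‖φ w‖ ≤ Mφ * ‖w‖) (hφ' : ∀ X, ‖φ.symm X‖ ≤ Mφ' * ‖X‖) (hstar : ∀ X : 𝔸, ‖star X‖ ≤ ‖X‖)
  (ha : 0 < a) (ha' : 0 < a') (hϱ0 : 0 ≤ ϱ) (hϱ1 : ϱ < 1)
  {Cτ : ℝ} (hτ : ∀ X, ‖τ X‖ ≤ Cτ * ‖X‖) (hCτ : 0 ≤ Cτ) {Mτ : ℝ} (hτm : ∀ X Y : 𝔸, ‖τ (X * Y)‖ ≤ Mτ * ‖X‖ * ‖Y‖) (hMτ : 0 ≤ Mτ)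
  (hρw : 0 ≤ ρw)

set_option maxHeartbeats 800000 in -- the two displayed blocks + (K86)'s block: as G-3
include hd hL hL3 hMφ hMφ' hφ hφ' hstar ha ha' hϱ0 hϱ1 hτ hCτ hτm hMτ hρw hτ₁ hτ₂ hφτ in
/-- **THE (117) SOCKET FOR THE FULL `𝔊̃_k` FROM THE TWO HÖLDER LETTERS OF Thm 3.1 FOR `G′_k(U)`** — this lineage's G-3
`B11Eq117FrakGkPiTransformationNorm.exists_norm_toCLM115_frakGkPi_le_of_thirdWord` with its one displayed letter `H3` DISCHARGED by §2: the end-to-end statement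
«`‖toCLM115 ∇_U 𝔊̃_k‖ ≤ max(w̄₀B, w̄₁B)·w̲⁻¹` ⇐ (3.43)₂-type letter of `R_kG′_kD*_U` + (3.44)-type letter of `∇_UD_UG′_k`» on the cell's MODEL (the docking is by literal
type: the junction's conclusion IS `H3`). [cite: Balaban1985Variational, (117) p.295, (110)–(111) p.294; Balaban1985BackgroundPropagators, Thm 3.13 p.426, Thm 3.1
(3.43)–(3.44) pp.397–398, (3.152)–(3.153) p.426] -/
theorem exists_norm_toCLM115_frakGkPi_le_of_holderLetters
    (HLa : ∃ ε αa Ba δa : ℝ, 0 < ε ∧ ε ≤ 1 ∧ 0 < αa ∧ 0 ≤ Ba ∧ 0 < δa ∧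
      ∀ (n : ℕ) (η : ℝ) (_hηL : η * (L : ℝ) ^ (n + 1) = 1) (c₀ c₁ : ℝ) [Fact (0 < c₀)] [Fact (0 < c₁)]
        (_hw : c₀ * ((L : ℝ) ^ (n + 1)) ^ d = c₁) (_hρ : |η| ^ d / c₀ ≤ ρw) (m : Fin d → ℕ) [∀ i, NeZero (m i)] (_hm : ∀ i, 1 ≤ m i)
        (U : Bond d (towerP L m (n + 1)) → 𝔸ˣ) (αU : ℕ → ℝ) (_hα0 : ∀ j, 0 ≤ αU j) (hα1 : ∀ j, αU j ≤ 1 / 64)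
        (hU1 : ∀ (j : ℕ) (x : B7Prop1Explicit.Site d) (k : Fin d), perCfg (towerP L m (j + 1)) (UlevOf L m (n + 1) U j) x k ∈ U1 𝔸)
        (hreg : ∀ (j : ℕ) (y : TSite d (towerP L m j)) (k : Fin d) (ρ' : Fin d → Fin L),
          ‖((Wcx L (perCfg (towerP L m (j + 1)) (UlevOf L m (n + 1) U j)) (cornerSite L y) k (boxVec L ρ') : 𝔸ˣ) : 𝔸) - 1‖ ≤ αU j)
        (εU : ℕ → ℝ) (_hεU : ∀ j, 0 ≤ εU j) (_hUε : ∀ (j : ℕ) (b : Bond d (towerP L m (j + 1))), ‖(UlevOf L m (n + 1) U j b : 𝔸) - 1‖ ≤ εU j)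
        (_hLb : ∀ (j : ℕ) (b : Bond d (towerP L m (j + 1))), UlevOf L m (n + 1) U j b ∈ U1 𝔸)
        (α : ℝ) (_hα : 0 ≤ α) (_hαle : α ≤ αa)
        (hUst : ∀ b, star (U b : 𝔸) = (((U b)⁻¹ : 𝔸ˣ) : 𝔸)) (_hUb : ∀ b, U b ∈ U1 𝔸) (_hUη : ∀ b, ‖(U b : 𝔸) - 1‖ ≤ α * η)
        (_hpl : ∀ p : B9SectCLatticeCarrier.Plaq d (towerP L m (n + 1)), ‖(plaqHolU U p : 𝔸) - 1‖ ≤ α * η ^ 2)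
        (_hUgrad : ∀ (x : TSite d (towerP L m (n + 1))) (μ : Fin d), ‖(U (x, μ) : 𝔸) - U (unshift μ x, μ)‖ ≤ α * η ^ 2)
        (_hRlev : ∀ (j : ℕ) (b : Bond d (towerP L m (j + 1))) (w : W), ‖adTransportW φ (UlevOf L m (n + 1) U j) b w‖ ≤ ‖w‖)
        (_hεg : ∀ j < n + 1, εU j ≤ α * ϱ ^ j) (_hAQ : ∑ j ∈ Finset.range (n + 1), αU j ≤ AQ)
        (hpos' : ∀ x : SiteL2K ℂ d (towerP L m (n + 1)) c₀ W, x ≠ 0 → 0 < RCLike.re ⟪x, laplacePrimeAk L m n φ η U a' (c₁ := c₁) x⟫_ℂ)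
        (hpos : ∀ x : BondL2K ℂ d (towerP L m (n + 1)) c₀ W, x ≠ 0 →
          0 < RCLike.re ⟪x, laplaceAk L m n φ η U hL αU hα1 hU1 hreg τ (c₀ := c₀) (c₁ := c₁) a x⟫_ℂ)
        (hposπ : ∀ x : BondL2K ℂ d (towerP L m (n + 1)) c₀ W, x ≠ 0 →
          0 < RCLike.re ⟪x, laplaceAkPi L m n φ τ η U a' hpos' hL αU hα1 hU1 hreg (c₁ := c₁) a x⟫_ℂ)
        (_hc₀ : c₀ = η ^ d)
        (_hJ : ∀ (μ : Fin d) (y : TSite d (towerP L m (n + 1))),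
          ‖B9Eq39Adjoint.J (fun μ => B9Eq33CovDerivVector.shiftEquiv μ) (fun μ y => U (y, μ)) η μ y‖ ≤ α)
        (v : TSite d m) (f : BondL2K ℂ d (towerP L m (n + 1)) c₀ W) (F : ℝ)
        (_hfv : ∀ b, blockCoord (L ^ (n + 1)) m (siteCast (towerP_eq_fineP_pow L m (n + 1)) (bpos b)) ≠ v →
          WL2.equiv ℂ (fun _ : Bond d (towerP L m (n + 1)) => c₀) W f b = 0)
        (_hfF : ∀ b, ‖WL2.equiv ℂ (fun _ : Bond d (towerP L m (n + 1)) => c₀) W f b‖ ≤ F) (x : TSite d (towerP L m (n + 1))),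
        ‖WL2.equiv ℂ (fun _ : TSite d (towerP L m (n + 1)) => c₀) W (RofUk L m n φ η U (GpOfUk L m n φ η U a' (c₁ := c₁) hpos' (covDivL2K ℂ c₀ ((η : ℂ))⁻¹ (adTransportW φ fun bb => (U bb)⁻¹) f))) x‖ ≤
          Ba * Real.exp (-(δa * tdist m (blockCoord (L ^ (n + 1)) m (siteCast (towerP_eq_fineP_pow L m (n + 1)) x)) v)) * F ∧
        ∀ x' : TSite d (towerP L m (n + 1)), tdist (towerP L m (n + 1)) x x' ≤ ((L ^ (n + 1) : ℕ) : ℝ) →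
          ‖WL2.equiv ℂ (fun _ : TSite d (towerP L m (n + 1)) => c₀) W (RofUk L m n φ η U (GpOfUk L m n φ η U a' (c₁ := c₁) hpos' (covDivL2K ℂ c₀ ((η : ℂ))⁻¹ (adTransportW φ fun bb => (U bb)⁻¹) f))) x' - WL2.equiv ℂ (fun _ : TSite d (towerP L m (n + 1)) => c₀) W (RofUk L m n φ η U (GpOfUk L m n φ η U a' (c₁ := c₁) hpos' (covDivL2K ℂ c₀ ((η : ℂ))⁻¹ (adTransportW φ fun bb => (U bb)⁻¹) f))) x‖ ≤
            Ba * Real.exp (-(δa * tdist m (blockCoord (L ^ (n + 1)) m (siteCast (towerP_eq_fineP_pow L m (n + 1)) x)) v)) * (tdist (towerP L m (n + 1)) x x' / ((L ^ (n + 1) : ℕ) : ℝ)) ^ ε * F)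
    (HLb : ∀ ε : ℝ, 0 < ε → ε ≤ 1 → ∃ αb Bb δb : ℝ, 0 < αb ∧ 0 ≤ Bb ∧ 0 < δb ∧
      ∀ (n : ℕ) (η : ℝ) (_hηL : η * (L : ℝ) ^ (n + 1) = 1) (c₀ c₁ : ℝ) [Fact (0 < c₀)] [Fact (0 < c₁)]
        (_hw : c₀ * ((L : ℝ) ^ (n + 1)) ^ d = c₁) (_hρ : |η| ^ d / c₀ ≤ ρw) (m : Fin d → ℕ) [∀ i, NeZero (m i)] (_hm : ∀ i, 1 ≤ m i)
        (U : Bond d (towerP L m (n + 1)) → 𝔸ˣ) (αU : ℕ → ℝ) (_hα0 : ∀ j, 0 ≤ αU j) (hα1 : ∀ j, αU j ≤ 1 / 64)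
        (hU1 : ∀ (j : ℕ) (x : B7Prop1Explicit.Site d) (k : Fin d), perCfg (towerP L m (j + 1)) (UlevOf L m (n + 1) U j) x k ∈ U1 𝔸)
        (hreg : ∀ (j : ℕ) (y : TSite d (towerP L m j)) (k : Fin d) (ρ' : Fin d → Fin L),
          ‖((Wcx L (perCfg (towerP L m (j + 1)) (UlevOf L m (n + 1) U j)) (cornerSite L y) k (boxVec L ρ') : 𝔸ˣ) : 𝔸) - 1‖ ≤ αU j)
        (εU : ℕ → ℝ) (_hεU : ∀ j, 0 ≤ εU j) (_hUε : ∀ (j : ℕ) (b : Bond d (towerP L m (j + 1))), ‖(UlevOf L m (n + 1) U j b : 𝔸) - 1‖ ≤ εU j)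
        (_hLb : ∀ (j : ℕ) (b : Bond d (towerP L m (j + 1))), UlevOf L m (n + 1) U j b ∈ U1 𝔸)
        (α : ℝ) (_hα : 0 ≤ α) (_hαle : α ≤ αb)
        (hUst : ∀ b, star (U b : 𝔸) = (((U b)⁻¹ : 𝔸ˣ) : 𝔸)) (_hUb : ∀ b, U b ∈ U1 𝔸) (_hUη : ∀ b, ‖(U b : 𝔸) - 1‖ ≤ α * η)
        (_hpl : ∀ p : B9SectCLatticeCarrier.Plaq d (towerP L m (n + 1)), ‖(plaqHolU U p : 𝔸) - 1‖ ≤ α * η ^ 2)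
        (_hUgrad : ∀ (x : TSite d (towerP L m (n + 1))) (μ : Fin d), ‖(U (x, μ) : 𝔸) - U (unshift μ x, μ)‖ ≤ α * η ^ 2)
        (_hRlev : ∀ (j : ℕ) (b : Bond d (towerP L m (j + 1))) (w : W), ‖adTransportW φ (UlevOf L m (n + 1) U j) b w‖ ≤ ‖w‖)
        (_hεg : ∀ j < n + 1, εU j ≤ α * ϱ ^ j) (_hAQ : ∑ j ∈ Finset.range (n + 1), αU j ≤ AQ)
        (hpos' : ∀ x : SiteL2K ℂ d (towerP L m (n + 1)) c₀ W, x ≠ 0 → 0 < RCLike.re ⟪x, laplacePrimeAk L m n φ η U a' (c₁ := c₁) x⟫_ℂ)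
        (hpos : ∀ x : BondL2K ℂ d (towerP L m (n + 1)) c₀ W, x ≠ 0 →
          0 < RCLike.re ⟪x, laplaceAk L m n φ η U hL αU hα1 hU1 hreg τ (c₀ := c₀) (c₁ := c₁) a x⟫_ℂ)
        (hposπ : ∀ x : BondL2K ℂ d (towerP L m (n + 1)) c₀ W, x ≠ 0 →
          0 < RCLike.re ⟪x, laplaceAkPi L m n φ τ η U a' hpos' hL αU hα1 hU1 hreg (c₁ := c₁) a x⟫_ℂ)
        (_hc₀ : c₀ = η ^ d)
        (_hJ : ∀ (μ : Fin d) (y : TSite d (towerP L m (n + 1))),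
          ‖B9Eq39Adjoint.J (fun μ => B9Eq33CovDerivVector.shiftEquiv μ) (fun μ y => U (y, μ)) η μ y‖ ≤ α)
        (y' : TSite d m) (lam : SiteL2K ℂ d (towerP L m (n + 1)) c₀ W) (N H : ℝ) (_hN : 0 ≤ N) (_hH : 0 ≤ H)
        (_hsupp : ∀ x, WL2.equiv ℂ (fun _ : TSite d (towerP L m (n + 1)) => c₀) W lam x ≠ 0 → tdist m (blockCoord (L ^ (n + 1)) m (siteCast (towerP_eq_fineP_pow L m (n + 1)) x)) y' ≤ 1)
        (_hval : ∀ x, ‖WL2.equiv ℂ (fun _ : TSite d (towerP L m (n + 1)) => c₀) W lam x‖ ≤ N)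
        (_hhol : ∀ x x' : TSite d (towerP L m (n + 1)), tdist (towerP L m (n + 1)) x x' ≤ ((L ^ (n + 1) : ℕ) : ℝ) →
          ‖WL2.equiv ℂ (fun _ : TSite d (towerP L m (n + 1)) => c₀) W lam x' - WL2.equiv ℂ (fun _ : TSite d (towerP L m (n + 1)) => c₀) W lam x‖ ≤ H * (tdist (towerP L m (n + 1)) x x' / ((L ^ (n + 1) : ℕ) : ℝ)) ^ ε)
        (μ : Fin d) (b : Bond d (towerP L m (n + 1))),
        ‖WL2.equiv ℂ (fun _ : Bond d (towerP L m (n + 1)) => c₀) W (covDerivL2K ℂ c₀ ((η : ℂ))⁻¹ (adTransportW φ U)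
            ((WL2.equiv ℂ (fun _ : TSite d (towerP L m (n + 1)) => c₀) W).symm fun y => WL2.equiv ℂ (fun _ : Bond d (towerP L m (n + 1)) => c₀) W (covDerivL2K ℂ c₀ ((η : ℂ))⁻¹ (adTransportW φ U) (GpOfUk L m n φ η U a' (c₁ := c₁) hpos' lam)) (y, μ))) b‖ ≤
          Bb * Real.exp (-(δb * tdist m (blockCoord (L ^ (n + 1)) m (siteCast (towerP_eq_fineP_pow L m (n + 1)) (bpos b))) y')) * (N + H)) :
    ∃ α₁ j₁ B : ℝ, 0 < α₁ ∧ 0 < j₁ ∧ 0 ≤ B ∧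
      ∀ (n : ℕ) (η : ℝ) (_hηL : η * (L : ℝ) ^ (n + 1) = 1) (c₀ c₁ : ℝ) [Fact (0 < c₀)] [Fact (0 < c₁)]
        (_hw : c₀ * ((L : ℝ) ^ (n + 1)) ^ d = c₁) (_hρ : |η| ^ d / c₀ ≤ ρw) (m : Fin d → ℕ) [∀ i, NeZero (m i)] (_hm : ∀ i, 1 ≤ m i)
        (U : Bond d (towerP L m (n + 1)) → 𝔸ˣ) (αU : ℕ → ℝ) (_hα0 : ∀ j, 0 ≤ αU j) (hα1 : ∀ j, αU j ≤ 1 / 64)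
        (hαL : ∀ j, 50 * (d + 1) * αU j * (L : ℝ) ^ d ≤ 1 / 2)
        (hU1 : ∀ (j : ℕ) (x : B7Prop1Explicit.Site d) (k : Fin d), perCfg (towerP L m (j + 1)) (UlevOf L m (n + 1) U j) x k ∈ U1 𝔸)
        (hreg : ∀ (j : ℕ) (y : TSite d (towerP L m j)) (k : Fin d) (ρ' : Fin d → Fin L),
          ‖((Wcx L (perCfg (towerP L m (j + 1)) (UlevOf L m (n + 1) U j)) (cornerSite L y) k (boxVec L ρ') : 𝔸ˣ) : 𝔸) - 1‖ ≤ αU j)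
        (εU : ℕ → ℝ) (_hεU : ∀ j, 0 ≤ εU j) (_hUε : ∀ (j : ℕ) (b : Bond d (towerP L m (j + 1))), ‖(UlevOf L m (n + 1) U j b : 𝔸) - 1‖ ≤ εU j)
        (_hLb : ∀ (j : ℕ) (b : Bond d (towerP L m (j + 1))), UlevOf L m (n + 1) U j b ∈ U1 𝔸)
        (α : ℝ) (_hα : 0 ≤ α) (_hαle : α ≤ α₁)
        (hUst : ∀ b, star (U b : 𝔸) = (((U b)⁻¹ : 𝔸ˣ) : 𝔸)) (_hUb : ∀ b, U b ∈ U1 𝔸) (_hUη : ∀ b, ‖(U b : 𝔸) - 1‖ ≤ α * η)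
        (_hpl : ∀ p : B9SectCLatticeCarrier.Plaq d (towerP L m (n + 1)), ‖(plaqHolU U p : 𝔸) - 1‖ ≤ α * η ^ 2)
        (_hUgrad : ∀ (x : TSite d (towerP L m (n + 1))) (μ : Fin d), ‖(U (x, μ) : 𝔸) - U (unshift μ x, μ)‖ ≤ α * η ^ 2)
        (_hRlev : ∀ (j : ℕ) (b : Bond d (towerP L m (j + 1))) (w : W), ‖adTransportW φ (UlevOf L m (n + 1) U j) b w‖ ≤ ‖w‖)
        (_hεg : ∀ j < n + 1, εU j ≤ α * ϱ ^ j) (_hAQ : ∑ j ∈ Finset.range (n + 1), αU j ≤ AQ)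
        (hpos' : ∀ x : SiteL2K ℂ d (towerP L m (n + 1)) c₀ W, x ≠ 0 → 0 < RCLike.re ⟪x, laplacePrimeAk L m n φ η U a' (c₁ := c₁) x⟫_ℂ)
        (hpos : ∀ x : BondL2K ℂ d (towerP L m (n + 1)) c₀ W, x ≠ 0 →
          0 < RCLike.re ⟪x, laplaceAk L m n φ η U hL αU hα1 hU1 hreg τ (c₀ := c₀) (c₁ := c₁) a x⟫_ℂ)
        (_hc₀η : c₀ = η ^ d) (j₀ : ℝ) (_hJ : ∀ μ y, ‖B9Eq39Adjoint.J (fun μ => B9Eq33CovDerivVector.shiftEquiv μ) (fun μ y => U (y, μ)) η μ y‖ ≤ j₀) (_hj : j₀ ≤ j₁)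
        (hposπ : ∀ x : BondL2K ℂ d (towerP L m (n + 1)) c₀ W, x ≠ 0 →
          0 < RCLike.re ⟪x, laplaceAkPi L m n φ τ η U a' hpos' hL αU hα1 hU1 hreg (c₁ := c₁) a x⟫_ℂ)
        (hQ : Function.Surjective (QkW L m n φ U hL αU hα1 hU1 hreg (c₀ := c₀) (c₁ := c₁)))
        (Lw ηw : ℝ) [Fact (0 < Lw)] [Fact (0 < ηw)] (lev₀ : Bond d (towerP L m (n + 1)) → ℕ) (lev₁ : Bond d (towerP L m (n + 1)) × Fin d → ℕ),
        ‖toCLM115 (L := Lw) (η := ηw) (lev₀ := lev₀) lev₁ (covGrad ((η : ℂ))⁻¹ (adTransportW φ U))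
            ((WL2.linearEquiv ℂ ℂ (fun _ : Bond d (towerP L m (n + 1)) => c₀)).toLinearMap ∘ₗ (frakGLatticeK hposπ hQ : _ →ₗ[ℂ] _) ∘ₗ
              ((WL2.linearEquiv ℂ ℂ (fun _ : Bond d (towerP L m (n + 1)) => c₀)).symm.toLinearMap :
                (Bond d (towerP L m (n + 1)) → W) →ₗ[ℂ] BondL2K ℂ d (towerP L m (n + 1)) c₀ W))‖ ≤
          max ((NegSup.wSup (levWeight Lw ηw lev₀ 1) : ℝ) * B) (NegSup.wSup (levWeight Lw ηw lev₁ 2) * B) *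
            NegSup.wInvSup (levWeight Lw ηw lev₀ 3) :=
  exists_norm_toCLM115_frakGkPi_le_of_thirdWord hd L hL hL3 φ hMφ hMφ' hφ hφ' hstar ha ha' hϱ0 hϱ1 τ hτ hCτ hτm hMτ hρw hτ₁ hτ₂ hφτ AQ
    (exists_local_gradLetter_thirdWord_of_holderLetters L hL φ τ hτ₁ hτ₂ hφτ AQ HLa HLb)

end Socket

end Literature.MathematicalPhysics.QuantumFieldTheory.Balaban1983to89.B9Eq3152ThirdWordPiGradRowOfHolderLetters

end
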